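import Mathlib
import HarnessLib

/-!
# K1L_D (stmt-AnomalousDissipation-27980), line «onelevel-design», brick Z4♭: the TEMPLATE BOOKKEEPING of (V)'s error — pure real inequalities
# (helper; `--supports … --as helper`; lead-k1l-onelevel-p1 g4)

`…FlatBilinearWindow.abs_inner_window_sub_le_sum` bounds the flat slow×slow window error by `Σ_S 2√2·err_ℓ·‖𝓕x‖‖𝓕y‖` with (V)'s error
`err_ℓ = C·(C·(ν^σ + (‖ℓ‖⌈K/ν⌉/N)^σ)·min(1, r̄_ℓ·aτ) + r̄_ℓ·(M·Wp/ν))`, `r̄_ℓ = 8π²‖ℓ‖²·hiΛ·(ν + c/ν)/N²`.  Under the template of the registered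
texts — `ν ≤ ρ^{1/4}` (T2), `physPeriod ≤ ρ^{1/16}·τ` (T5 and `τ ≥ refresh`), `‖ℓ‖ ≤ Lc/2 ≤ ρ^{1/64}·N·ν/(2√c)` (trim level), `M·Wp/ν = a·physPeriod`,
`0 < ρ ≤ 1` — THIS FILE proves, in pure real arithmetic,
  `err_ℓ ≤ CZ · ρ^{min(σ,2)/64} · min(1, rate_ℓ·τ)`, `rate_ℓ = a·8π²‖ℓ‖²·lo·(ν + c/ν)/N²`,
with the explicit constant `CZ = (hiΛ/lo)·C·(C·(1 + ((K+ν₀)/(2√c) + 1)^σ) + 2π²·lo·(ν₀²/c + 1)·M·Wp + 1)` (`errBound_le`), from the pieces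
`min_one_mul_le` (`κ ≥ 1 ⇒ min(1, κx) ≤ κ·min(1,x)`), `rpow_le_rpow_of_exponent_ge'`-type monotonicity in the exponent for `ρ ≤ 1`, and the two-case
estimate of the period term.  NOT a proof of any registered stub, of the crux, or of AD; rung F-D1.A0.
-/

set_option linter.dupNamespace false  -- the summit-side namespace `Summit.AnomalousDissipation.AnomalousDissipation.…` repeats a component by design (D-0017)

noncomputable section

namespace Summit.AnomalousDissipation.AnomalousDissipation.Theorems.SolenoidalFractalHomogenisation.LagrangianStep.FlatWindow

open Real

/-- `κ ≥ 1` ⇒ `min(1, κx) ≤ κ·min(1, x)`. -/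
theorem min_one_mul_le {κ x : ℝ} (hκ : 1 ≤ κ) : min 1 (κ * x) ≤ κ * min 1 x := by
  rcases le_or_gt x 1 with h | h
  · rw [min_eq_right h]; exact min_le_right _ _
  · rw [min_eq_left h.le, mul_one]; exact (min_le_left _ _).trans hκ

/-- For `0 < ρ ≤ 1` and exponents `e₁ ≤ e₂`: `ρ^{e₂} ≤ ρ^{e₁}`. -/
theorem rpow_le_rpow_of_le_one {ρ e₁ e₂ : ℝ} (hρ0 : 0 < ρ) (hρ1 : ρ ≤ 1) (he : e₁ ≤ e₂) : ρ ^ e₂ ≤ ρ ^ e₁ :=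
  Real.rpow_le_rpow_of_exponent_ge hρ0 hρ1 he

/-- **The bookkeeping inequality.**  See the module docstring; all quantities are reals. -/
theorem errBound_le {C σ ν ν₀ K c lo hi Λ M Wp N a τ physP ρ nℓ : ℝ}
    (hC : 0 ≤ C) (hσ : 0 < σ) (hν : 0 < ν) (hνν₀ : ν ≤ ν₀) (hK : 0 ≤ K) (hc : 0 < c) (hlo : 0 < lo) (hhi : lo ≤ hi) (hΛ : 1 ≤ Λ)
    (hM : 0 < M) (hWp : 0 < Wp) (hN : 0 < N) (ha : 0 < a) (hτ : 0 < τ) (hρ0 : 0 < ρ) (hρ1 : ρ ≤ 1)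
    (hνρ : ν ≤ ρ ^ (1 / 4 : ℝ)) (hnℓ : 0 ≤ nℓ) (hℓρ : nℓ ≤ ρ ^ (1 / 64 : ℝ) * N * ν / (2 * Real.sqrt c))
    (hP : M * Wp / ν = a * physP) (hτP : physP ≤ ρ ^ (1 / 16 : ℝ) * τ) :
    C * (C * (ν ^ σ + (nℓ * (⌈K / ν⌉₊ : ℝ) / N) ^ σ)
          * min 1 ((8 * Real.pi ^ 2 * nℓ ^ 2 * (hi * Λ) * (ν + c / ν) / N ^ 2) * (a * τ))
        + (8 * Real.pi ^ 2 * nℓ ^ 2 * (hi * Λ) * (ν + c / ν) / N ^ 2) * (M * Wp / ν))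
      ≤ ((hi * Λ / lo) * C * (C * (1 + ((K + ν₀) / (2 * Real.sqrt c) + 1) ^ σ) + (2 * Real.pi ^ 2 * lo * (ν₀ ^ 2 / c + 1) * M * Wp + 1)))
        * ρ ^ (min σ 2 / 64) * min 1 (a * (8 * Real.pi ^ 2 * nℓ ^ 2 * lo * (ν + c / ν) / N ^ 2) * τ) := by
  -- names
  set d : ℝ := min 1 (a * (8 * Real.pi ^ 2 * nℓ ^ 2 * lo * (ν + c / ν) / N ^ 2) * τ) with hd_def
  set rate : ℝ := a * (8 * Real.pi ^ 2 * nℓ ^ 2 * lo * (ν + c / ν) / N ^ 2) with hrate_def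
  set rbar : ℝ := 8 * Real.pi ^ 2 * nℓ ^ 2 * (hi * Λ) * (ν + c / ν) / N ^ 2 with hrbar_def
  set κ : ℝ := hi * Λ / lo with hκ_def
  set σz : ℝ := min σ 2 / 64 with hσz
  have hν₀ : 0 < ν₀ := hν.trans_le hνν₀
  have hνc : 0 < ν + c / ν := by positivity
  have hhi0 : 0 < hi := hlo.trans_le hhi
  have hκ1 : 1 ≤ κ := by
    rw [hκ_def, le_div_iff₀ hlo, one_mul]
    nlinarith [hhi, hΛ, hhi0]
  have hκ0 : 0 ≤ κ := zero_le_one.trans hκ1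
  have hrate0 : 0 ≤ rate := by positivity
  have hd0 : 0 ≤ d := le_min zero_le_one (mul_nonneg hrate0 hτ.le)
  have hd1 : d ≤ 1 := min_le_left _ _
  have hρσz : 0 ≤ ρ ^ σz := (Real.rpow_pos_of_pos hρ0 _).le
  have hσz0 : 0 < σz := by rw [hσz]; have := lt_min hσ (by norm_num : (0:ℝ) < 2); positivity
  -- `rbar = κ · rate / a`, `rbar · (aτ) = κ · rate · τ`
  have hrbar : rbar = κ * rate / a := by
    rw [hrbar_def, hκ_def, hrate_def]; field_simp
  have hrbar0 : 0 ≤ rbar := by rw [hrbar]; positivity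
  -- (a) the `min` term
  have hA : min 1 (rbar * (a * τ)) ≤ κ * d := by
    have e : rbar * (a * τ) = κ * (rate * τ) := by rw [hrbar]; field_simp
    rw [e, hd_def]
    exact min_one_mul_le hκ1
  -- (b) `ν^σ ≤ ρ^{σz}`
  have hB : ν ^ σ ≤ ρ ^ σz := by
    calc ν ^ σ ≤ (ρ ^ (1 / 4 : ℝ)) ^ σ := Real.rpow_le_rpow hν.le hνρ hσ.le
      _ = ρ ^ (σ / 4) := by rw [← Real.rpow_mul hρ0.le]; ring_nf
      _ ≤ ρ ^ σz := rpow_le_rpow_of_le_one hρ0 hρ1 (by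
          rw [hσz]; have := min_le_left σ 2; linarith)
  -- (c) the scale-ratio term
  have hceil : (⌈K / ν⌉₊ : ℝ) ≤ K / ν + 1 := by
    have h0 : 0 ≤ K / ν := by positivity
    exact (Nat.ceil_lt_add_one h0).le
  have hC' : (nℓ * (⌈K / ν⌉₊ : ℝ) / N) ^ σ ≤ ((K + ν₀) / (2 * Real.sqrt c) + 1) ^ σ * ρ ^ σz := by
    have hsc : 0 < 2 * Real.sqrt c := by positivity
    have h1 : nℓ * (⌈K / ν⌉₊ : ℝ) / N ≤ ρ ^ (1 / 64 : ℝ) * ((K + ν₀) / (2 * Real.sqrt c) + 1) := by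
      have step1 : nℓ * (⌈K / ν⌉₊ : ℝ) / N ≤ (ρ ^ (1 / 64 : ℝ) * N * ν / (2 * Real.sqrt c)) * (K / ν + 1) / N :=
        div_le_div_of_nonneg_right (mul_le_mul hℓρ hceil (Nat.cast_nonneg _) (by positivity)) hN.le
      have step2 : (ρ ^ (1 / 64 : ℝ) * N * ν / (2 * Real.sqrt c)) * (K / ν + 1) / N
          = ρ ^ (1 / 64 : ℝ) * ((K + ν) / (2 * Real.sqrt c)) := by
        field_simp
      have step3 : (K + ν) / (2 * Real.sqrt c) ≤ (K + ν₀) / (2 * Real.sqrt c) + 1 := by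
        have : (K + ν) / (2 * Real.sqrt c) ≤ (K + ν₀) / (2 * Real.sqrt c) := div_le_div_of_nonneg_right (by linarith) hsc.le
        linarith
      calc nℓ * (⌈K / ν⌉₊ : ℝ) / N ≤ ρ ^ (1 / 64 : ℝ) * ((K + ν) / (2 * Real.sqrt c)) := step1.trans (le_of_eq step2)
        _ ≤ ρ ^ (1 / 64 : ℝ) * ((K + ν₀) / (2 * Real.sqrt c) + 1) :=
          mul_le_mul_of_nonneg_left step3 (Real.rpow_pos_of_pos hρ0 _).le
    have h0 : 0 ≤ nℓ * (⌈K / ν⌉₊ : ℝ) / N := by positivity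
    calc (nℓ * (⌈K / ν⌉₊ : ℝ) / N) ^ σ ≤ (ρ ^ (1 / 64 : ℝ) * ((K + ν₀) / (2 * Real.sqrt c) + 1)) ^ σ := Real.rpow_le_rpow h0 h1 hσ.le
      _ = ((K + ν₀) / (2 * Real.sqrt c) + 1) ^ σ * ρ ^ (σ / 64) := by
        rw [Real.mul_rpow (Real.rpow_pos_of_pos hρ0 _).le (by positivity), ← Real.rpow_mul hρ0.le]; ring_nf
      _ ≤ ((K + ν₀) / (2 * Real.sqrt c) + 1) ^ σ * ρ ^ σz :=
        mul_le_mul_of_nonneg_left (rpow_le_rpow_of_le_one hρ0 hρ1 (by rw [hσz]; have := min_le_left σ 2; linarith)) (by positivity)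
  -- (d) the period term `rbar · (M Wp/ν) = κ · rate · physP ≤ κ (B₀ + 1) ρ^{σz} d`
  have hD : rbar * (M * Wp / ν) ≤ κ * (2 * Real.pi ^ 2 * lo * (ν₀ ^ 2 / c + 1) * M * Wp + 1) * ρ ^ σz * d := by
    have e : rbar * (M * Wp / ν) = κ * (rate * physP) := by rw [hP, hrbar]; field_simp
    rw [e, show κ * (2 * Real.pi ^ 2 * lo * (ν₀ ^ 2 / c + 1) * M * Wp + 1) * ρ ^ σz * d
        = κ * ((2 * Real.pi ^ 2 * lo * (ν₀ ^ 2 / c + 1) * M * Wp + 1) * ρ ^ σz * d) by ring]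
    refine mul_le_mul_of_nonneg_left ?_ hκ0
    have hρ32 : ρ ^ (1 / 32 : ℝ) ≤ ρ ^ σz := rpow_le_rpow_of_le_one hρ0 hρ1 (by rw [hσz]; have := min_le_right σ 2; linarith)
    have hρ16 : ρ ^ (1 / 16 : ℝ) ≤ ρ ^ σz := rpow_le_rpow_of_le_one hρ0 hρ1 (by rw [hσz]; have := min_le_right σ 2; linarith)
    have hB0 : 0 ≤ 2 * Real.pi ^ 2 * lo * (ν₀ ^ 2 / c + 1) * M * Wp := by positivity
    rcases le_or_gt (rate * τ) 1 with hsmall | hbig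
    · -- `d = rate·τ`, `physP ≤ ρ^{1/16} τ`
      have hd : d = rate * τ := by rw [hd_def, min_eq_right hsmall]
      calc rate * physP ≤ rate * (ρ ^ (1 / 16 : ℝ) * τ) := mul_le_mul_of_nonneg_left hτP hrate0
        _ = ρ ^ (1 / 16 : ℝ) * d := by rw [hd]; ring
        _ ≤ ρ ^ σz * d := mul_le_mul_of_nonneg_right hρ16 hd0
        _ ≤ (2 * Real.pi ^ 2 * lo * (ν₀ ^ 2 / c + 1) * M * Wp + 1) * (ρ ^ σz * d) := by
          have : 1 ≤ 2 * Real.pi ^ 2 * lo * (ν₀ ^ 2 / c + 1) * M * Wp + 1 := by linarith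
          exact le_mul_of_one_le_left (mul_nonneg hρσz hd0) this
        _ = (2 * Real.pi ^ 2 * lo * (ν₀ ^ 2 / c + 1) * M * Wp + 1) * ρ ^ σz * d := by ring
    · -- `d = 1`, `rate·physP ≤ 2π² lo (ν²/c + 1) M Wp ρ^{1/32}`
      have hd : d = 1 := by rw [hd_def, min_eq_left hbig.le]
      have hnℓ2 : nℓ ^ 2 ≤ ρ ^ (1 / 32 : ℝ) * N ^ 2 * ν ^ 2 / (4 * c) := by
        have h0 : 0 ≤ ρ ^ (1 / 64 : ℝ) * N * ν / (2 * Real.sqrt c) := by positivity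
        calc nℓ ^ 2 ≤ (ρ ^ (1 / 64 : ℝ) * N * ν / (2 * Real.sqrt c)) ^ 2 := pow_le_pow_left₀ hnℓ hℓρ 2
          _ = ρ ^ (1 / 32 : ℝ) * N ^ 2 * ν ^ 2 / (4 * c) := by
            rw [div_pow, mul_pow, mul_pow, ← Real.rpow_natCast (ρ ^ (1 / 64 : ℝ)) 2, ← Real.rpow_mul hρ0.le, mul_pow,
              Real.sq_sqrt hc.le]
            norm_num
      have hrateP : rate * physP ≤ 2 * Real.pi ^ 2 * lo * (ν₀ ^ 2 / c + 1) * M * Wp * ρ ^ (1 / 32 : ℝ) := by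
        have ephys : physP = M * Wp / (ν * a) := by
          field_simp at hP ⊢; linarith
        rw [hrate_def, ephys]
        have e1 : a * (8 * Real.pi ^ 2 * nℓ ^ 2 * lo * (ν + c / ν) / N ^ 2) * (M * Wp / (ν * a))
            = 8 * Real.pi ^ 2 * lo * M * Wp * (nℓ ^ 2 * ((ν + c / ν) / (ν * N ^ 2))) := by field_simp
        rw [e1]
        have e2 : nℓ ^ 2 * ((ν + c / ν) / (ν * N ^ 2)) ≤ (ρ ^ (1 / 32 : ℝ) * N ^ 2 * ν ^ 2 / (4 * c)) * ((ν + c / ν) / (ν * N ^ 2)) :=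
          mul_le_mul_of_nonneg_right hnℓ2 (by positivity)
        have e3 : (ρ ^ (1 / 32 : ℝ) * N ^ 2 * ν ^ 2 / (4 * c)) * ((ν + c / ν) / (ν * N ^ 2)) = ρ ^ (1 / 32 : ℝ) * ((ν ^ 2 / c + 1) / 4) := by
          field_simp
        have e4 : ν ^ 2 / c + 1 ≤ ν₀ ^ 2 / c + 1 := by
          have : ν ^ 2 ≤ ν₀ ^ 2 := pow_le_pow_left₀ hν.le hνν₀ 2
          have := div_le_div_of_nonneg_right this hc.le
          linarith
        calc 8 * Real.pi ^ 2 * lo * M * Wp * (nℓ ^ 2 * ((ν + c / ν) / (ν * N ^ 2)))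
            ≤ 8 * Real.pi ^ 2 * lo * M * Wp * (ρ ^ (1 / 32 : ℝ) * ((ν ^ 2 / c + 1) / 4)) :=
              mul_le_mul_of_nonneg_left (e2.trans (le_of_eq e3)) (by positivity)
          _ ≤ 8 * Real.pi ^ 2 * lo * M * Wp * (ρ ^ (1 / 32 : ℝ) * ((ν₀ ^ 2 / c + 1) / 4)) := by
              refine mul_le_mul_of_nonneg_left (mul_le_mul_of_nonneg_left (by linarith) (Real.rpow_pos_of_pos hρ0 _).le) (by positivity)
          _ = 2 * Real.pi ^ 2 * lo * (ν₀ ^ 2 / c + 1) * M * Wp * ρ ^ (1 / 32 : ℝ) := by ring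
      calc rate * physP ≤ 2 * Real.pi ^ 2 * lo * (ν₀ ^ 2 / c + 1) * M * Wp * ρ ^ (1 / 32 : ℝ) := hrateP
        _ ≤ 2 * Real.pi ^ 2 * lo * (ν₀ ^ 2 / c + 1) * M * Wp * ρ ^ σz := mul_le_mul_of_nonneg_left hρ32 hB0
        _ ≤ (2 * Real.pi ^ 2 * lo * (ν₀ ^ 2 / c + 1) * M * Wp + 1) * ρ ^ σz * d := by
          rw [hd, mul_one]; exact mul_le_mul_of_nonneg_right (by linarith) hρσz
  -- assemble
  have hX0 : 0 ≤ ν ^ σ + (nℓ * (⌈K / ν⌉₊ : ℝ) / N) ^ σ := by positivity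
  have hmin0 : 0 ≤ min 1 (rbar * (a * τ)) := le_min zero_le_one (by positivity)
  calc C * (C * (ν ^ σ + (nℓ * (⌈K / ν⌉₊ : ℝ) / N) ^ σ) * min 1 (rbar * (a * τ)) + rbar * (M * Wp / ν))
      ≤ C * (C * ((1 + ((K + ν₀) / (2 * Real.sqrt c) + 1) ^ σ) * ρ ^ σz) * (κ * d)
          + κ * (2 * Real.pi ^ 2 * lo * (ν₀ ^ 2 / c + 1) * M * Wp + 1) * ρ ^ σz * d) := by
        refine mul_le_mul_of_nonneg_left (add_le_add ?_ hD) hC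
        refine mul_le_mul (mul_le_mul_of_nonneg_left ?_ hC) hA hmin0 (by positivity)
        calc ν ^ σ + (nℓ * (⌈K / ν⌉₊ : ℝ) / N) ^ σ ≤ ρ ^ σz + ((K + ν₀) / (2 * Real.sqrt c) + 1) ^ σ * ρ ^ σz := add_le_add hB hC'
          _ = (1 + ((K + ν₀) / (2 * Real.sqrt c) + 1) ^ σ) * ρ ^ σz := by ring
    _ = (κ * C * (C * (1 + ((K + ν₀) / (2 * Real.sqrt c) + 1) ^ σ) + (2 * Real.pi ^ 2 * lo * (ν₀ ^ 2 / c + 1) * M * Wp + 1)))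
        * ρ ^ σz * d := by ring

end Summit.AnomalousDissipation.AnomalousDissipation.Theorems.SolenoidalFractalHomogenisation.LagrangianStep.FlatWindow

end
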